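import Literature.AlgebraicGeometry.Resolution.KrullRamificationHenselRoots
import HarnessLib

/-!
# Henselian generators of the subfields of the inertia field of a Krull valuation

Topic: `Literature/AlgebraicGeometry/Resolution` (valued function fields), continuing
`KrullRamificationHenselRoots.lean` (frame: an ambient valued field `(Ω, V)`, a subfield
`M ⊆ Ω`, a finite Galois `N | M` inside `Ω`, and the groups `G_Z ⊇ G_T` of `V ∩ N`,
Zariski–Samuel VI §12). There the decomposition field `N^{G_Z}` and the inertia field `N^{G_T}`
were shown to be generated by HENSELIAN ELEMENTS. Here we prove the statement for EVERY
intermediate field of `N^{G_T} | M` at once: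

* `exists_henselRoot_adjoin_eq_fixedField` — PROVED: for every subgroup `H ⊇ G_T` of
  `Gal(N | M)`, `N^H = M(η)` with `η ∈ V` a root of a monic `F ∈ (V ∩ M)[X]` such that `F'(η)`
  is a unit of `V` (so the stabiliser of `η` is exactly `H` and `v(σ η − η) = 0` for `σ ∉ H`);
  `exists_henselRoot_toSubfield_fixedField_eq` reads it in `Ω`, and
  `exists_henselRoot_adjoin_eq_of_le_inertiaField` is the form "every `K'` with
  `M ⊆ K' ⊆ N^{G_T}` is `M(η)` with `η` henselian over `V ∩ M`".

This is the elementwise content of the characterisation of the absolute inertia field as the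
union of the finite subextensions `F | K` with `O_F` local-étale over `O_K` (Knaf–Kuhlmann 2009,
Lemma 3.7 (3): "`O_P|O_L` is local-étale if and only if `(F,P)` lies in the absolute inertia
field of `(L,P)`", whose proof is "See [Ray], Ch. X, Thm. 1"), and it is the valuation-theoretic
input of Cossart–Piltant 2008, Cor. 6.3 ("let `K'`, `K ⊆ K' ⊆ Kⁱ`, where `Kⁱ` is the inertia
field of `W|V` …"), which climbs local uniformization from `V` to `W ∩ K'` for an ARBITRARY
subfield `K'` of the inertia field — the case `K' = Kⁱ` being `KrullRamificationHenselRoots`.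

Method (elementary, avoiding local-étale algebras and the henselization, neither of which is
in Mathlib). Write `O = V ∩ N`, `K' = N^H`.
1. (`exists_crt_orbit`) Weak approximation in the finitely many pairwise incomparable
   conjugates `σ • O` (`ValuationRingsApproximation.lean`) gives an `H`-invariant `e ∈ K'` with
   all conjugates in `V`, `e ≡ 1 (mod 𝔪_V)`, and `σ e ∈ 𝔪_V` unless `σ⁻¹ • O` lies in the
   `H`-orbit of `O`.
2. (`exists_witness_of_not_mem`, the key step) For `ζ ∈ G_Z ∖ H` some `H`-invariant `x` with
   all conjugates in `V` has its residue moved by `ζ̄`: otherwise, with `w` an element whose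
   residue is moved by every `h̄⁻¹ζ̄` (`h ∈ H ∩ G_Z`; these lie outside `G_T`, and Nagata's
   exponent `exists_geom_sum_forall_coe_map_mem` normalises the witnesses so that all their
   conjugates lie in `V`) and `y ≡ w` at `O`, `∈ 𝔪` at the other conjugates, the `H`-invariant
   polynomial `P = ∏_{h ∈ H} (X − h y)` would give `P(ζ y) ≡ P^ζ(ζ y) = 0`, i.e. `ζ y ≡ h y`
   for some `h ∈ H` — impossible for `h ∉ G_Z` (`h y ∈ 𝔪`, `ζ y` a unit) and for `h ∈ G_Z`
   (`h⁻¹ζ w ≡ w`).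
3. (avoidance, `exists_forall_not_lt_of_forall_exists`) The residues of the `H`-invariant
   elements all of whose conjugates lie in `V` form an `Mv`-subalgebra of `Nv`, which is not
   the union of the fixed loci of the finitely many `ζ̄`, `ζ ∈ G_Z ∖ H` (over an infinite `Mv`:
   Mathlib's `Submodule.exists_forall_notMem_of_forall_ne_top`; over a finite `Mv` the finite
   domain is a field with cyclic unit group): one `η₁` works for all `ζ`.
4. `η = e η₁`: for `σ ∉ H`, either `σ⁻¹ • O = h • O` with `h ∈ H`, and then `σ η = ζ η` with
   `ζ = σ h ∈ G_Z ∖ H` and `v(ζ η − η) = v(ζ η₁ − η₁) = 0`; or `σ η ∈ 𝔪_V`. Hence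
   `Stab(η) = H` and `F = ∏_{σ ∈ G/H} (X − σ η)` has `F'(η)` a unit.

Everything is PROVED; no named facts are introduced.

## Sources

* H. Knaf, F.-V. Kuhlmann, *Every place admits local uniformization in a finite extension of
  the function field*, Adv. Math. 221 (2009), Lemma 3.7 (3) (arXiv:math/0702856, p. 13).
  [KnafKuhlmann2009]
* O. Zariski, P. Samuel, *Commutative Algebra* II (1960), Ch. VI §12. [ZariskiSamuel1960]
* V. Cossart, O. Piltant, J. Algebra 320 (2008), Cor. 6.3 (HAL p. 19). [CossartPiltant2008]
-/

noncomputable section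

open Module IntermediateField IsLocalRing Polynomial
open scoped Pointwise

namespace Literature.AlgebraicGeometry.Resolution

universe u

section InertiaSubfields

variable {Ω : Type u} [Field Ω] (V : ValuationSubring Ω) {M : Subfield Ω}
  (N : IntermediateField M Ω)

/-- `σ y ∈ V` iff `y ∈ σ⁻¹ • (V ∩ N)`. [folklore] -/
theorem coe_map_mem_iff (σ : N ≃ₐ[M] N) (y : N) :
    ((σ y : N) : Ω) ∈ V ↔ y ∈ σ⁻¹ • V.comap (algebraMap N Ω) := by
  rw [_root_.ValuationSubring.mem_inv_pointwise_smul_iff, AlgEquiv.smul_def,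
    _root_.ValuationSubring.mem_comap]
  rfl

/-- `σ y ∈ 𝔪_V` iff `y` lies in the maximal ideal of `σ⁻¹ • (V ∩ N)`. [folklore] -/
theorem valuation_coe_map_lt_one_iff (σ : N ≃ₐ[M] N) (y : N) :
    V.valuation ((σ y : N) : Ω) < 1 ↔ (σ⁻¹ • V.comap (algebraMap N Ω)).valuation y < 1 := by
  rw [valuation_smul_lt_one_iff, inv_inv, AlgEquiv.smul_def,
    valuation_comap_intermediateField_lt_one_iff]

/-- `y ∈ N` is a unit of `V ∩ N` iff `v(y) = 1`. [folklore] -/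
theorem valuation_comap_intermediateField_eq_one_iff (y : N) :
    (V.comap (algebraMap N Ω)).valuation y = 1 ↔ V.valuation (y : Ω) = 1 := by
  have hlt := valuation_comap_intermediateField_lt_one_iff V N y
  constructor
  · intro h
    have hmem : (y : Ω) ∈ V := ((V.comap (algebraMap N Ω)).valuation_le_one_iff y).mp h.le
    rcases ((V.valuation_le_one_iff _).mpr hmem).lt_or_eq with h1 | h1
    · -- contradiction with `h`
      have h2 := hlt.mpr h1
      rw [h] at h2
      exact absurd h2 (lt_irrefl _)
    · exact h1
  · intro h
    have hmem : (y : Ω) ∈ V := (V.valuation_le_one_iff _).mp h.le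
    have hmem' : y ∈ V.comap (algebraMap N Ω) := hmem
    rcases (((V.comap (algebraMap N Ω)).valuation_le_one_iff y).mpr hmem').lt_or_eq with h1 | h1
    · have h2 := hlt.mp h1
      rw [h] at h2
      exact absurd h2 (lt_irrefl _)
    · exact h1

/-- **Nagata normalisation against the conjugates of `V ∩ N`.** For `x ∈ V ∩ N` there is an
exponent `e` such that, with `u = 1 + x + ⋯ + x^{e-1}`: `u` is a unit of `V`, and `1/u` and
`x/u` have ALL their `M`-conjugates in `V` (Nagata's exponent
`ValuationSubring.exists_geom_sum_valuation_eq_one` for the finite family `σ • (V ∩ N)`).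
[folklore] -/
theorem exists_geom_sum_forall_coe_map_mem [FiniteDimensional M N] (x : N) (hx : (x : Ω) ∈ V) :
    ∃ e : ℕ, V.valuation ((∑ k ∈ Finset.range e, x ^ k : N) : Ω) = 1 ∧
      (∀ σ : N ≃ₐ[M] N, ((σ (∑ k ∈ Finset.range e, x ^ k)⁻¹ : N) : Ω) ∈ V) ∧
      (∀ σ : N ≃ₐ[M] N, ((σ (x * (∑ k ∈ Finset.range e, x ^ k)⁻¹) : N) : Ω) ∈ V) := by
  classical
  let O : _root_.ValuationSubring N := V.comap (algebraMap N Ω)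
  obtain ⟨e, he2, he⟩ :=
    ValuationSubring.exists_geom_sum_valuation_eq_one (fun σ : N ≃ₐ[M] N => σ • O) x
  set u : N := ∑ k ∈ Finset.range e, x ^ k with hu
  have hxO : x ∈ O := hx
  have hOu : O.valuation u = 1 := by
    have h := he 1 (by rw [one_smul]; exact hxO)
    rwa [one_smul] at h
  have hVu : V.valuation (u : Ω) = 1 := (valuation_comap_intermediateField_eq_one_iff V N u).mp hOu
  have key : ∀ τ : N ≃ₐ[M] N, u⁻¹ ∈ τ • O ∧ x * u⁻¹ ∈ τ • O := by
    intro τ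
    by_cases hxτ : x ∈ τ • O
    · have h1 : (τ • O).valuation u = 1 := he τ hxτ
      have hui : u⁻¹ ∈ τ • O := by
        rw [← (τ • O).valuation_le_one_iff, map_inv₀, h1, inv_one]
      exact ⟨hui, mul_mem hxτ hui⟩
    · have hlt : 1 < (τ • O).valuation x := by
        rw [← not_le, (τ • O).valuation_le_one_iff]
        exact hxτ
      obtain ⟨n, hn⟩ := Nat.exists_eq_add_of_le' (by omega : 1 ≤ e)
      have hvu : (τ • O).valuation u = (τ • O).valuation x ^ n := by
        rw [hu, hn]
        exact ValuationSubring.valuation_geom_sum_of_one_lt _ hlt n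
      have hux : (τ • O).valuation x ≤ (τ • O).valuation u := by
        rw [hvu]
        calc (τ • O).valuation x = (τ • O).valuation x ^ 1 := (pow_one _).symm
          _ ≤ (τ • O).valuation x ^ n := pow_le_pow_right₀ hlt.le (by omega)
      have hu1 : 1 < (τ • O).valuation u := lt_of_lt_of_le hlt hux
      have hvu0 : (τ • O).valuation u ≠ 0 := ne_of_gt (lt_trans zero_lt_one hu1)
      refine ⟨?_, ?_⟩
      · rw [← (τ • O).valuation_le_one_iff, map_inv₀]
        exact inv_le_one_of_one_le₀ hu1.le
      · rw [← (τ • O).valuation_le_one_iff, map_mul, map_inv₀]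
        calc (τ • O).valuation x * ((τ • O).valuation u)⁻¹
            ≤ (τ • O).valuation u * ((τ • O).valuation u)⁻¹ :=
              mul_le_mul_left hux _
          _ = 1 := mul_inv_cancel₀ hvu0
  exact ⟨e, hVu, fun σ => (coe_map_mem_iff V N σ _).mpr (key σ⁻¹).1,
    fun σ => (coe_map_mem_iff V N σ _).mpr (key σ⁻¹).2⟩

/-- **Weak approximation along an orbit of conjugates.** For a subgroup `H` of `Gal(N|M)`
there is an `H`-invariant `e ∈ N`, all of whose conjugates lie in `V`, with `e ≡ 1 (mod 𝔪_V)`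
and `σ e ∈ 𝔪_V` whenever `σ⁻¹ • (V ∩ N)` is not of the form `h • (V ∩ N)`, `h ∈ H` (sum the
Chinese-remainder elements of `ValuationSubring.exists_crt_of_forall_le_imp_eq` over the
`H`-orbit of `V ∩ N`, then multiply the `H`-conjugates). [folklore] -/
theorem exists_crt_orbit [FiniteDimensional M N] (H : Subgroup (N ≃ₐ[M] N)) :
    ∃ e : N, (∀ h ∈ H, h e = e) ∧ (∀ σ : N ≃ₐ[M] N, ((σ e : N) : Ω) ∈ V) ∧
      V.valuation ((e : Ω) - 1) < 1 ∧
      ∀ σ : N ≃ₐ[M] N,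
        (∀ h ∈ H, σ⁻¹ • V.comap (algebraMap N Ω) ≠ h • V.comap (algebraMap N Ω)) →
          V.valuation ((σ e : N) : Ω) < 1 := by
  classical
  let O : _root_.ValuationSubring N := V.comap (algebraMap N Ω)
  let ι : Type u := ↥(Set.range (fun σ : N ≃ₐ[M] N => σ • O))
  haveI : Finite ι := (Set.finite_range _).to_subtype
  haveI : Fintype ι := Fintype.ofFinite ι
  let R : ι → _root_.ValuationSubring N := fun i => i.1
  have hR : ∀ i j, R i ≤ R j → i = j := by
    rintro ⟨_, σ, rfl⟩ ⟨_, τ, rfl⟩ hle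
    apply Subtype.ext
    refine ValuationSubring.eq_of_le_of_comap_eq (F := M) hle ?_
    rw [comap_smul_algEquiv, comap_smul_algEquiv]
  have hcrt : ∀ j : ι, ∃ f : N, (∀ i, f ∈ R i) ∧ (R j).valuation (f - 1) < 1 ∧
      ∀ i, i ≠ j → (R i).valuation f < 1 := fun j =>
    ValuationSubring.exists_crt_of_forall_le_imp_eq R hR j
  choose f hfR hf1 hflt using hcrt
  -- the `H`-orbit of `O` and the element `e₃ ≡ 1` on it, `∈ 𝔪` off it
  let J : Finset ι := Finset.univ.filter fun i => ∃ h ∈ H, (i.1 : _root_.ValuationSubring N) = h • O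
  have hJ : ∀ i : ι, i ∈ J ↔ ∃ h ∈ H, (i.1 : _root_.ValuationSubring N) = h • O := fun i => by
    simp only [J, Finset.mem_filter, Finset.mem_univ, true_and]
  let e₃ : N := ∑ j ∈ J, f j
  have he₃R : ∀ i, e₃ ∈ R i := fun i => sum_mem fun j _ => hfR j i
  have he₃one : ∀ i ∈ J, (R i).valuation (e₃ - 1) < 1 := by
    intro i hi
    have hsplit : e₃ - 1 = (f i - 1) + ∑ j ∈ J.erase i, f j := by
      change (∑ j ∈ J, f j) - 1 = _
      rw [← Finset.add_sum_erase J f hi]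
      ring
    rw [hsplit]
    refine Valuation.map_add_lt _ (hf1 i) ?_
    exact (R i).valuation.map_sum_lt one_ne_zero fun j hj =>
      hflt j i (Finset.ne_of_mem_erase hj).symm
  have he₃lt : ∀ i, i ∉ J → (R i).valuation e₃ < 1 := fun i hi =>
    (R i).valuation.map_sum_lt one_ne_zero fun j hj => hflt j i fun h => hi (h ▸ hj)
  -- conjugates of `e₃`
  have he₃V : ∀ σ : N ≃ₐ[M] N, ((σ e₃ : N) : Ω) ∈ V := fun σ =>
    (coe_map_mem_iff V N σ _).mpr (he₃R ⟨σ⁻¹ • O, σ⁻¹, rfl⟩)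
  have he₃one' : ∀ σ : N ≃ₐ[M] N, (∃ h ∈ H, σ⁻¹ • O = h • O) →
      V.valuation (((σ e₃ : N) : Ω) - 1) < 1 := by
    intro σ hσ
    have h1 : V.valuation (((σ (e₃ - 1) : N)) : Ω) < 1 := by
      rw [valuation_coe_map_lt_one_iff]
      exact he₃one ⟨σ⁻¹ • O, σ⁻¹, rfl⟩ ((hJ _).mpr hσ)
    rw [map_sub, map_one] at h1
    push_cast at h1
    exact h1
  have he₃lt' : ∀ σ : N ≃ₐ[M] N, (∀ h ∈ H, σ⁻¹ • O ≠ h • O) →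
      V.valuation ((σ e₃ : N) : Ω) < 1 := by
    intro σ hσ
    rw [valuation_coe_map_lt_one_iff]
    exact he₃lt ⟨σ⁻¹ • O, σ⁻¹, rfl⟩ fun hJ' => by
      obtain ⟨h, hh, hho⟩ := (hJ _).mp hJ'
      exact hσ h hh hho
  -- the `H`-invariant product
  haveI : Fintype ↥H := Fintype.ofFinite _
  let e : N := ∏ h : ↥H, (h : N ≃ₐ[M] N) e₃
  have hconj : ∀ σ : N ≃ₐ[M] N, σ e = ∏ h : ↥H, ((σ * (h : N ≃ₐ[M] N)) e₃ : N) := fun σ => by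
    change σ (∏ h : ↥H, (h : N ≃ₐ[M] N) e₃) = _
    rw [map_prod]
    exact Finset.prod_congr rfl fun h _ => (AlgEquiv.mul_apply σ (h : N ≃ₐ[M] N) e₃).symm
  refine ⟨e, fun h₀ hh₀ => ?_, fun σ => ?_, ?_, fun σ hσ => ?_⟩
  · -- `H`-invariance
    rw [hconj]
    change ∏ h : ↥H, ((h₀ * (h : N ≃ₐ[M] N)) e₃ : N) = ∏ h : ↥H, ((h : N ≃ₐ[M] N) e₃ : N)
    exact Fintype.prod_equiv (Equiv.mulLeft (⟨h₀, hh₀⟩ : ↥H))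
      (fun h : ↥H => ((h₀ * (h : N ≃ₐ[M] N)) e₃ : N)) (fun h : ↥H => ((h : N ≃ₐ[M] N) e₃ : N))
      (fun h => rfl)
  · -- conjugates in `V`
    rw [hconj]
    push_cast
    exact prod_mem fun h _ => he₃V _
  · -- `e ≡ 1`
    change V.valuation (((∏ h : ↥H, (h : N ≃ₐ[M] N) e₃ : N) : Ω) - 1) < 1
    push_cast
    refine valuation_prod_sub_one_lt_one V _ _ fun h _ => he₃one' _ ⟨(h : N ≃ₐ[M] N)⁻¹, ?_, ?_⟩
    · exact H.inv_mem h.2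
    · rfl
  · -- `σ e ∈ 𝔪` off the orbit
    rw [hconj]
    push_cast
    refine ValuationSubring.valuation_prod_lt_one V Finset.univ _ (fun h _ => ?_)
      (Finset.mem_univ (1 : ↥H)) ?_
    · exact (V.valuation_le_one_iff _).mpr (he₃V _)
    · have h1 : ((1 : ↥H) : N ≃ₐ[M] N) = 1 := rfl
      rw [h1, mul_one]
      exact he₃lt' σ hσ


/-! ### Avoidance of finitely many proper fixed subspaces -/

/-- **Avoidance in a subalgebra of a finite extension.** If `S` is a subalgebra of a finite
extension `E | F` and finitely many `F`-algebra maps `ψᵢ : E → E` each move some element of `S`,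
then one element of `S` is moved by all of them: over an infinite `F` the fixed loci are proper
subspaces of `S` (Mathlib's `Submodule.exists_forall_notMem_of_forall_ne_top`); over a finite `F`
the finite domain `S` is a field and a generator of `Sˣ` works. [folklore] -/
theorem Subalgebra.exists_mem_forall_apply_ne {F E : Type*} [Field F] [Field E] [Algebra F E]
    [FiniteDimensional F E] (S : Subalgebra F E) {ι : Type*} [Finite ι] (ψ : ι → (E →ₐ[F] E))
    (h : ∀ i, ∃ s ∈ S, ψ i s ≠ s) : ∃ s ∈ S, ∀ i, ψ i s ≠ s := by
  classical
  let W : ι → Submodule F ↥S := fun i =>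
    LinearMap.ker (((ψ i).toLinearMap.comp S.val.toLinearMap) - S.val.toLinearMap)
  have hW : ∀ i (s : ↥S), s ∈ W i ↔ ψ i (s : E) = s := fun i s => by
    change s ∈ LinearMap.ker _ ↔ _
    rw [LinearMap.mem_ker, LinearMap.sub_apply, sub_eq_zero]
    rfl
  have hWtop : ∀ i, W i ≠ ⊤ := fun i htop => by
    obtain ⟨s, hs, hne⟩ := h i
    exact hne ((hW i ⟨s, hs⟩).mp (htop ▸ Submodule.mem_top))
  have havoid : ∃ s : ↥S, ∀ i, s ∉ W i := by
    by_cases hF : Finite F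
    · haveI : Finite E := Module.finite_of_finite F
      haveI : Finite ↥S := Subtype.finite
      have hfield : IsField ↥S := Finite.isField_of_domain ↥S
      obtain ⟨g, hg⟩ := IsCyclic.exists_monoid_generator (α := (↥S)ˣ)
      refine ⟨(g : ↥S), fun i hi => hWtop i ?_⟩
      rw [hW] at hi
      rw [eq_top_iff]
      rintro s -
      rw [hW]
      by_cases hs : s = 0
      · rw [hs, ZeroMemClass.coe_zero, map_zero]
      · obtain ⟨b, hb⟩ := hfield.mul_inv_cancel hs
        obtain ⟨n, hn⟩ := (Submonoid.mem_powers_iff _ _).mp (hg (Units.mkOfMulEqOne s b hb))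
        have hs' : s = (g : ↥S) ^ n := by
          rw [← Units.val_pow_eq_pow_val, hn, Units.val_mkOfMulEqOne]
        rw [hs', SubmonoidClass.coe_pow, map_pow, hi]
    · haveI : Infinite F := not_finite_iff_infinite.mp hF
      exact Submodule.exists_forall_notMem_of_forall_ne_top W hWtop
  obtain ⟨s, hs⟩ := havoid
  exact ⟨s, s.2, fun i hi => hs i ((hW i s).mpr hi)⟩

/-- **An element with prescribed integrality pattern whose residue is moved by finitely many
elements of `G_Z`.** Let `P` be a property of elements of `N` stable under `+` and `·`, implying
membership in `V` and satisfied by `V ∩ M` (e.g. "all conjugates lie in `V`", possibly together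
with "fixed by a subgroup `H`"). If each `ζ` of a set `Bad ⊆ G_Z` moves the residue of some
element with `P`, then one element with `P` has its residue moved by every `ζ ∈ Bad` (the
residues of the elements with `P` form a subalgebra of the residue field extension `Nv | Mv`,
to which `Subalgebra.exists_mem_forall_apply_ne` applies with the residue maps `ζ̄`).
[folklore] -/
theorem exists_forall_not_lt_of_forall_exists [FiniteDimensional M N] (P : N → Prop)
    (hPV : ∀ x, P x → (x : Ω) ∈ V) (hPM : ∀ c : M, (c : Ω) ∈ V → P (algebraMap M N c))
    (hPadd : ∀ x y, P x → P y → P (x + y)) (hPmul : ∀ x y, P x → P y → P (x * y))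
    (Bad : Set (N ≃ₐ[M] N)) (hBad : Bad ⊆ decompositionGroupIn V N)
    (hwit : ∀ ζ ∈ Bad, ∃ x, P x ∧ ¬ V.valuation (((ζ x : N) : Ω) - x) < 1) :
    ∃ y, P y ∧ ∀ ζ ∈ Bad, ¬ V.valuation (((ζ y : N) : Ω) - y) < 1 := by
  classical
  haveI : FiniteDimensional (residueSubfield M V)
      (Subfield.extendScalars (residueSubfield_base_le V N)) :=
    finiteDimensional_residueSubfield (V := V) (L := N)
  let BadT : Type u := ↥Bad
  haveI : Finite BadT := Subtype.finite
  -- residue maps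
  have hψ : ∀ b : BadT, ∃ ψ : Subfield.extendScalars (residueSubfield_base_le V N)
      →ₐ[residueSubfield M V] Subfield.extendScalars (residueSubfield_base_le V N),
      ∀ (x : N) (hx : (x : Ω) ∈ V),
        (ψ ⟨residue V ⟨x, hx⟩, residue_mem_residueSubfield_intermediateField V x hx⟩ :
            ResidueField V) =
          residue V ⟨(b.1 x : N), ((mem_decompositionGroupIn_iff V N b.1).mp (hBad b.2) x).mp hx⟩ :=
    fun b => exists_residueAlgHom_of_mem_decompositionGroupIn V N (hBad b.2)
  choose ψ hψ using hψ
  -- the residue of an element of `V ∩ N`, in `Nv`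
  let res : ∀ x : N, (x : Ω) ∈ V → Subfield.extendScalars (residueSubfield_base_le V N) :=
    fun x hx => ⟨residue V ⟨x, hx⟩, residue_mem_residueSubfield_intermediateField V x hx⟩
  have hres_add : ∀ (x y : N) (hx : (x : Ω) ∈ V) (hy : (y : Ω) ∈ V),
      res (x + y) (by push_cast; exact V.add_mem _ _ hx hy) = res x hx + res y hy := by
    intro x y hx hy
    apply Subtype.ext
    change residue V _ = residue V _ + residue V _
    rw [← map_add]
    congr 1
  have hres_mul : ∀ (x y : N) (hx : (x : Ω) ∈ V) (hy : (y : Ω) ∈ V),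
      res (x * y) (by push_cast; exact V.mul_mem _ _ hx hy) = res x hx * res y hy := by
    intro x y hx hy
    apply Subtype.ext
    change residue V _ = residue V _ * residue V _
    rw [← map_mul]
    congr 1
  -- the subalgebra of residues of `P`-elements
  let S : Subalgebra (residueSubfield M V) (Subfield.extendScalars (residueSubfield_base_le V N)) :=
    { carrier := {r | ∃ (x : N) (hx : (x : Ω) ∈ V), P x ∧ res x hx = r}
      mul_mem' := by
        rintro _ _ ⟨x, hx, hPx, rfl⟩ ⟨y, hy, hPy, rfl⟩
        exact ⟨x * y, by push_cast; exact V.mul_mem _ _ hx hy, hPmul x y hPx hPy,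
          hres_mul x y hx hy⟩
      add_mem' := by
        rintro _ _ ⟨x, hx, hPx, rfl⟩ ⟨y, hy, hPy, rfl⟩
        exact ⟨x + y, by push_cast; exact V.add_mem _ _ hx hy, hPadd x y hPx hPy,
          hres_add x y hx hy⟩
      algebraMap_mem' := by
        intro r
        obtain ⟨c, hc, hcr⟩ := (mem_residueSubfield_subfield_iff V (r : ResidueField V)).mp r.2
        refine ⟨algebraMap M N c, hc, hPM c hc, Subtype.ext ?_⟩
        change residue V ⟨((algebraMap M N c : N) : Ω), _⟩ = (r : ResidueField V)
        rw [← hcr]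
        exact congrArg (residue V) (Subtype.ext rfl) }
  have hS : ∀ r, r ∈ S ↔ ∃ (x : N) (hx : (x : Ω) ∈ V), P x ∧ res x hx = r := fun r => Iff.rfl
  -- fixed residues read on representatives
  have hfix_iff : ∀ (b : BadT) (x : N) (hx : (x : Ω) ∈ V),
      ψ b (res x hx) = res x hx ↔ V.valuation (((b.1 x : N) : Ω) - x) < 1 := fun b x hx => by
    rw [← residue_mk_eq_iff V (((mem_decompositionGroupIn_iff V N b.1).mp (hBad b.2) x).mp hx) hx,
      ← hψ b x hx]
    exact ⟨fun h => congrArg Subtype.val h, fun h => Subtype.ext h⟩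
  -- witnesses in `S`
  have hwit' : ∀ b : BadT, ∃ s ∈ S, ψ b s ≠ s := by
    rintro ⟨ζ, hζ⟩
    obtain ⟨x, hPx, hne⟩ := hwit ζ hζ
    exact ⟨res x (hPV x hPx), ⟨x, hPV x hPx, hPx, rfl⟩, fun h =>
      hne ((hfix_iff ⟨ζ, hζ⟩ x (hPV x hPx)).mp h)⟩
  obtain ⟨s, hsS, hs⟩ := Subalgebra.exists_mem_forall_apply_ne S ψ hwit'
  obtain ⟨y, hy, hPy, rfl⟩ := (hS s).mp hsS
  exact ⟨y, hPy, fun ζ hζ hlt => hs ⟨ζ, hζ⟩ ((hfix_iff ⟨ζ, hζ⟩ y hy).mpr hlt)⟩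


/-! ### Polynomial bookkeeping -/

/-- The coefficients of `∏ᵢ (X − rᵢ)` with all `rᵢ` in a valuation ring `O` lie in `O`.
[folklore] -/
theorem coeff_prod_X_sub_C_mem {K : Type u} [Field K] (O : _root_.ValuationSubring K)
    {ι : Type*} (s : Finset ι) (r : ι → K) (hr : ∀ i ∈ s, r i ∈ O) (k : ℕ) :
    (∏ i ∈ s, (X - C (r i))).coeff k ∈ O := by
  classical
  have hlift : (∏ i ∈ s, (X - C (r i))) ∈ Polynomial.lifts (O.subtype : O →+* K) := by
    refine Subsemiring.prod_mem _ fun i hi => ?_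
    have hq : -(r i) ∈ O := O.neg_mem _ (hr i hi)
    have : X - C (r i) = X + C ((O.subtype : O →+* K) ⟨_, hq⟩) := by
      rw [sub_eq_add_neg, ← C_neg]
      rfl
    rw [this]
    exact Subsemiring.add_mem _ (Polynomial.X_mem_lifts _) (Polynomial.C_mem_lifts _ _)
  obtain ⟨c, hc⟩ := (Polynomial.lifts_iff_coeff_lifts _).mp hlift k
  rw [← hc]
  exact c.2

/-- `g • ∏ᵢ (X − rᵢ) = ∏ᵢ (X − g rᵢ)` for a Galois automorphism `g`. [folklore] -/
theorem smul_prod_X_sub_C (g : N ≃ₐ[M] N) {ι : Type*} (s : Finset ι) (r : ι → N) :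
    g • ∏ i ∈ s, (X - C (r i)) = ∏ i ∈ s, (X - C (g (r i))) := by
  rw [Finset.smul_prod']
  refine Finset.prod_congr rfl fun i _ => ?_
  rw [smul_sub, Polynomial.smul_X, Polynomial.smul_C, AlgEquiv.smul_def]

/-! ### Witnesses of non-inertia inside a subfield of the inertia field -/

/-- For `σ ∈ G_Z`, congruences modulo `𝔪_V` are preserved by `σ`. [folklore] -/
theorem valuation_map_sub_lt_one_of_mem_decompositionGroupIn {σ : N ≃ₐ[M] N}
    (hσ : σ ∈ decompositionGroupIn V N) {x y : N} (h : V.valuation ((x : Ω) - y) < 1) :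
    V.valuation (((σ x : N) : Ω) - (σ y : N)) < 1 := by
  have h1 : V.valuation (((x - y : N)) : Ω) < 1 := by push_cast; exact h
  have h2 := (valuation_lt_one_iff_of_mem_decompositionGroupIn V N hσ _).mp h1
  rw [map_sub] at h2
  push_cast at h2
  exact h2

/-- For `σ ∈ G_Z`, units of `V` in `N` are mapped to units of `V`. [folklore] -/
theorem valuation_map_eq_one_of_mem_decompositionGroupIn {σ : N ≃ₐ[M] N}
    (hσ : σ ∈ decompositionGroupIn V N) {x : N} (hx : V.valuation (x : Ω) = 1) :
    V.valuation ((σ x : N) : Ω) = 1 := by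
  have hxV : (x : Ω) ∈ V := (V.valuation_le_one_iff _).mp hx.le
  have hσx : ((σ x : N) : Ω) ∈ V := ((mem_decompositionGroupIn_iff V N σ).mp hσ x).mp hxV
  rcases ((V.valuation_le_one_iff _).mpr hσx).lt_or_eq with h1 | h1
  · have h2 := (valuation_lt_one_iff_of_mem_decompositionGroupIn V N hσ x).mpr h1
    rw [hx] at h2
    exact absurd h2 (lt_irrefl _)
  · exact h1

/-- **Key step.** Let `H ≥ G_T` and `ζ ∈ G_Z ∖ H`. Then `ζ̄` moves the residue of some
`H`-invariant element all of whose conjugates lie in `V`. (Otherwise: take `y ≡ w` at `V`, `∈ 𝔪`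
at the other conjugates of `V ∩ N`, with `w̄` moved by every `h̄⁻¹ζ̄`, `h ∈ H ∩ G_Z`; the
`H`-invariant polynomial `P = ∏_{h ∈ H} (X − h y)` would satisfy `P(ζ y) ≡ P^ζ(ζ y) = 0`, so
`ζ y ≡ h y` for some `h ∈ H`; `h ∉ G_Z` is impossible since then `h y ∈ 𝔪`, and `h ∈ G_Z`
gives `h⁻¹ζ w ≡ w`, a contradiction.) [folklore] -/
theorem exists_witness_of_not_mem [FiniteDimensional M N] [IsGalois M N]
    (H : Subgroup (N ≃ₐ[M] N)) (hH : inertiaGroupIn V N ≤ H)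
    {ζ : N ≃ₐ[M] N} (hζZ : ζ ∈ decompositionGroupIn V N) (hζH : ζ ∉ H) :
    ∃ x : N, (∀ h ∈ H, h x = x) ∧ (∀ σ : N ≃ₐ[M] N, ((σ x : N) : Ω) ∈ V) ∧
      ¬ V.valuation (((ζ x : N) : Ω) - x) < 1 := by
  classical
  let O : _root_.ValuationSubring N := V.comap (algebraMap N Ω)
  let Z : Subgroup (N ≃ₐ[M] N) := decompositionGroupIn V N
  let T : Subgroup (N ≃ₐ[M] N) := inertiaGroupIn V N
  have hZV : ∀ σ ∈ Z, ∀ x : N, (x : Ω) ∈ V → ((σ x : N) : Ω) ∈ V := fun σ hσ x hx =>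
    ((mem_decompositionGroupIn_iff V N σ).mp hσ x).mp hx
  have hZlt : ∀ σ ∈ Z, ∀ x : N, V.valuation (x : Ω) < 1 → V.valuation ((σ x : N) : Ω) < 1 :=
    fun σ hσ x => (valuation_lt_one_iff_of_mem_decompositionGroupIn V N hσ x).mp
  have hZsub : ∀ σ ∈ Z, ∀ x y : N, V.valuation ((x : Ω) - y) < 1 →
      V.valuation (((σ x : N) : Ω) - (σ y : N)) < 1 := fun σ hσ x y h =>
    valuation_map_sub_lt_one_of_mem_decompositionGroupIn V N hσ h
  have hZunit : ∀ σ ∈ Z, ∀ x : N, V.valuation (x : Ω) = 1 →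
      V.valuation ((σ x : N) : Ω) = 1 := fun σ hσ x hx =>
    valuation_map_eq_one_of_mem_decompositionGroupIn V N hσ hx
  -- the bad automorphisms `h⁻¹ ζ`, `h ∈ H ∩ G_Z`
  let Bad : Set (N ≃ₐ[M] N) := {τ | ∃ h ∈ H, h ∈ Z ∧ τ = h⁻¹ * ζ}
  have hBadZ : Bad ⊆ (Z : Set (N ≃ₐ[M] N)) := by
    rintro τ ⟨h, -, hhZ, rfl⟩
    exact Z.mul_mem (Z.inv_mem hhZ) hζZ
  have hBadT : ∀ τ ∈ Bad, τ ∉ T := by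
    rintro τ ⟨h, hhH, -, rfl⟩ hT
    apply hζH
    have : ζ = h * (h⁻¹ * ζ) := (mul_inv_cancel_left h ζ).symm
    rw [this]
    exact H.mul_mem hhH (hH hT)
  -- witnesses with all conjugates in `V`
  have hwit : ∀ τ ∈ Bad, ∃ x : N, (∀ σ : N ≃ₐ[M] N, ((σ x : N) : Ω) ∈ V) ∧
      ¬ V.valuation (((τ x : N) : Ω) - x) < 1 := by
    intro τ hτ
    have hτZ : τ ∈ Z := hBadZ hτ
    obtain ⟨x₀, hx₀, hne⟩ : ∃ (x₀ : N), (x₀ : Ω) ∈ V ∧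
        ¬ V.valuation (((τ x₀ : N) : Ω) - x₀) < 1 := by
      by_contra h
      push Not at h
      exact hBadT τ hτ ((mem_inertiaGroupIn_iff V N τ).mpr
        ⟨(mem_decompositionGroupIn_iff V N τ).mp hτZ, fun x hx => h x hx⟩)
    obtain ⟨n, hu, hb, ha⟩ := exists_geom_sum_forall_coe_map_mem V N x₀ hx₀
    set u : N := ∑ k ∈ Finset.range n, x₀ ^ k with hu_def
    by_contra hno
    push Not at hno
    have ha' := hno (x₀ * u⁻¹) ha
    have hb' := hno u⁻¹ hb
    apply hne
    -- `τ u ≡ u`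
    have huV : (u : Ω) ∈ V := (V.valuation_le_one_iff _).mp hu.le
    have hτu : V.valuation ((τ u : N) : Ω) = 1 := hZunit τ hτZ u hu
    have hu0 : (u : Ω) ≠ 0 := fun h => by rw [h, map_zero] at hu; exact zero_ne_one hu
    have hτu0 : ((τ u : N) : Ω) ≠ 0 := fun h => by rw [h, map_zero] at hτu; exact zero_ne_one hτu
    have hτuu : V.valuation (((τ u : N) : Ω) - u) < 1 := by
      have heq : ((τ u : N) : Ω) - u = (τ u : N) * u * ((u⁻¹ : N) - (τ u⁻¹ : N)) := by
        rw [map_inv₀]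
        push_cast
        field_simp
      rw [heq, map_mul, map_mul, hτu, hu, one_mul, one_mul, Valuation.map_sub_swap]
      exact hb'
    -- `τ x₀ − x₀ = (τ a − a) τu + a (τ u − u)` with `a = x₀ / u`
    have haV : ((x₀ * u⁻¹ : N) : Ω) ∈ V := by simpa using ha 1
    have heq : ((τ x₀ : N) : Ω) - x₀ =
        (((τ (x₀ * u⁻¹) : N) : Ω) - (x₀ * u⁻¹ : N)) * (τ u : N) +
          (x₀ * u⁻¹ : N) * (((τ u : N) : Ω) - u) := by
      rw [map_mul, map_inv₀]
      push_cast
      field_simp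
      ring
    rw [heq]
    refine Valuation.map_add_lt _ ?_ ?_
    · rw [map_mul, hτu, mul_one]
      exact ha'
    · rw [map_mul]
      calc V.valuation ((x₀ * u⁻¹ : N) : Ω) * V.valuation (((τ u : N) : Ω) - u)
          ≤ 1 * V.valuation (((τ u : N) : Ω) - u) :=
            mul_le_mul_left ((V.valuation_le_one_iff _).mpr haV) _
        _ < 1 := by rw [one_mul]; exact hτuu
  -- Step 1: `w`, all conjugates in `V`, residue moved by every bad automorphism
  obtain ⟨w, hwV, hw⟩ := exists_forall_not_lt_of_forall_exists V N
    (fun x : N => ∀ σ : N ≃ₐ[M] N, ((σ x : N) : Ω) ∈ V)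
    (fun x hx => by simpa using hx 1)
    (fun c hc σ => by rw [AlgEquiv.commutes]; exact hc)
    (fun x y hx hy σ => by rw [map_add]; push_cast; exact V.add_mem _ _ (hx σ) (hy σ))
    (fun x y hx hy σ => by rw [map_mul]; push_cast; exact V.mul_mem _ _ (hx σ) (hy σ))
    Bad hBadZ hwit
  have hζBad : ζ ∈ Bad := ⟨1, H.one_mem, Z.one_mem, by rw [inv_one, one_mul]⟩
  have hwV1 : (w : Ω) ∈ V := by simpa using hwV 1
  have hvw : V.valuation (w : Ω) = 1 := by
    rcases ((V.valuation_le_one_iff _).mpr hwV1).lt_or_eq with h1 | h1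
    · exfalso
      refine hw ζ hζBad ?_
      rw [sub_eq_add_neg]
      refine Valuation.map_add_lt _ (hZlt ζ hζZ w h1) ?_
      rwa [Valuation.map_neg]
    · exact h1
  -- Step 2: `y ≡ w` at `V`, `∈ 𝔪` at the other conjugates
  obtain ⟨e, -, heV, he1, helt⟩ := exists_crt_orbit V N ⊥
  have helt' : ∀ σ : N ≃ₐ[M] N, σ ∉ Z → V.valuation ((σ e : N) : Ω) < 1 := by
    intro σ hσ
    refine helt σ fun h hh => ?_
    rw [Subgroup.mem_bot] at hh
    subst hh
    rw [one_smul]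
    intro hσO
    exact hσ (by simpa using Z.inv_mem ((mem_decompositionGroupIn_iff_smul_eq V N σ⁻¹).mpr hσO))
  let y : N := e * w
  have hyV : ∀ σ : N ≃ₐ[M] N, ((σ y : N) : Ω) ∈ V := fun σ => by
    change ((σ (e * w) : N) : Ω) ∈ V
    rw [map_mul]
    push_cast
    exact V.mul_mem _ _ (heV σ) (hwV σ)
  have hyw : V.valuation ((y : Ω) - w) < 1 := by
    have heq : (y : Ω) - w = ((e : Ω) - 1) * w := by
      change ((e * w : N) : Ω) - w = _
      push_cast
      ring
    rw [heq, map_mul, hvw, mul_one]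
    exact he1
  have hvy : V.valuation (y : Ω) = 1 := by
    have heq : (y : Ω) = w + ((y : Ω) - w) := by ring
    have hlt : V.valuation ((y : Ω) - w) < V.valuation (w : Ω) := by rw [hvw]; exact hyw
    rw [heq, V.valuation.map_add_eq_of_lt_left hlt, hvw]
  have hylt : ∀ σ : N ≃ₐ[M] N, σ ∉ Z → V.valuation ((σ y : N) : Ω) < 1 := by
    intro σ hσ
    change V.valuation ((σ (e * w) : N) : Ω) < 1
    rw [map_mul]
    push_cast
    rw [map_mul]
    calc V.valuation ((σ e : N) : Ω) * V.valuation ((σ w : N) : Ω)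
        ≤ V.valuation ((σ e : N) : Ω) * 1 :=
          mul_le_mul_right ((V.valuation_le_one_iff _).mpr (hwV σ)) _
      _ < 1 := by rw [mul_one]; exact helt' σ hσ
  -- Step 3: the `H`-invariant polynomial `P = ∏_{h ∈ H} (X − h y)`
  haveI : Fintype ↥H := Fintype.ofFinite _
  let P : N[X] := ∏ h : ↥H, (X - C ((h : N ≃ₐ[M] N) y))
  have hP : P = ∏ h : ↥H, (X - C ((h : N ≃ₐ[M] N) y)) := rfl
  have hPsmul : ∀ σ : N ≃ₐ[M] N, σ • P = ∏ h : ↥H, (X - C ((σ * (h : N ≃ₐ[M] N)) y)) := by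
    intro σ
    rw [hP, smul_prod_X_sub_C]
    rfl
  have hPfix : ∀ h₀ ∈ H, h₀ • P = P := by
    intro h₀ hh₀
    rw [hPsmul, hP]
    exact Fintype.prod_equiv (Equiv.mulLeft (⟨h₀, hh₀⟩ : ↥H))
      (fun h : ↥H => X - C (((h₀ * (h : N ≃ₐ[M] N)) y : N)))
      (fun h : ↥H => X - C (((h : N ≃ₐ[M] N) y : N))) (fun h => rfl)
  have hcfix : ∀ k, ∀ h₀ ∈ H, h₀ (P.coeff k) = P.coeff k := by
    intro k h₀ hh₀
    have h1 : h₀ • P.coeff k = P.coeff k := by rw [← Polynomial.coeff_smul, hPfix h₀ hh₀]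
    rwa [AlgEquiv.smul_def] at h1
  have hcV : ∀ k, ∀ σ : N ≃ₐ[M] N, ((σ (P.coeff k) : N) : Ω) ∈ V := by
    intro k σ
    have h1 : σ (P.coeff k) = (σ • P).coeff k := by
      rw [Polynomial.coeff_smul, AlgEquiv.smul_def]
    rw [h1, hPsmul]
    exact coeff_prod_X_sub_C_mem O Finset.univ _ (fun h _ => hyV _) k
  -- suppose the conclusion fails: then every coefficient of `P` is `≡ ζ`-fixed
  by_contra hcon
  push Not at hcon
  have hck : ∀ k, V.valuation (((ζ (P.coeff k) : N) : Ω) - (P.coeff k : N)) < 1 :=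
    fun k => hcon (P.coeff k) (hcfix k) (hcV k)
  -- `P(y) = 0`, hence `P^ζ(ζ y) = 0` and `P(ζ y) ∈ 𝔪`
  have hPy : P.eval y = 0 := by
    rw [hP, eval_prod]
    refine Finset.prod_eq_zero (Finset.mem_univ (1 : ↥H)) ?_
    rw [eval_sub, eval_X, eval_C]
    change y - (1 : N ≃ₐ[M] N) y = 0
    rw [AlgEquiv.one_apply, sub_self]
  have hPζy : (ζ • P).eval (ζ y) = 0 := by
    have h := Polynomial.smul_eval_smul _ ζ P y
    rw [AlgEquiv.smul_def, AlgEquiv.smul_def, hPy, map_zero] at h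
    exact h
  have hPζy' : V.valuation ((P.eval (ζ y) : N) : Ω) < 1 := by
    have heq : P.eval (ζ y) = (P - ζ • P).eval (ζ y) := by rw [eval_sub, hPζy, sub_zero]
    rw [heq, Polynomial.eval_eq_sum_range]
    push_cast
    refine V.valuation.map_sum_lt one_ne_zero fun i _ => ?_
    rw [Polynomial.coeff_sub, Polynomial.coeff_smul, AlgEquiv.smul_def]
    push_cast
    rw [map_mul, map_pow, Valuation.map_sub_swap]
    calc V.valuation (((ζ (P.coeff i) : N) : Ω) - (P.coeff i : N)) *
          V.valuation ((ζ y : N) : Ω) ^ i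
        ≤ V.valuation (((ζ (P.coeff i) : N) : Ω) - (P.coeff i : N)) * 1 := by
          refine mul_le_mul_right ?_ _
          exact pow_le_one₀ zero_le ((V.valuation_le_one_iff _).mpr (hyV ζ))
      _ < 1 := by rw [mul_one]; exact hck i
  -- `P(ζ y) = ∏_h (ζ y − h y)`: some factor lies in `𝔪`
  have hprod : (P.eval (ζ y) : N) = ∏ h : ↥H, (ζ y - (h : N ≃ₐ[M] N) y : N) := by
    rw [hP, eval_prod]
    exact Finset.prod_congr rfl fun h _ => by rw [eval_sub, eval_X, eval_C]
  obtain ⟨h, hh⟩ : ∃ h : ↥H, V.valuation (((ζ y : N) : Ω) - ((h : N ≃ₐ[M] N) y : N)) < 1 := by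
    by_contra hall
    push Not at hall
    have h1 : V.valuation ((P.eval (ζ y) : N) : Ω) = 1 := by
      rw [hprod]
      push_cast
      refine ValuationSubring.valuation_prod_eq_one V _ _ fun h _ => le_antisymm ?_ (hall h)
      have : ((ζ y : N) : Ω) - ((h : N ≃ₐ[M] N) y : N) ∈ V := sub_mem (hyV ζ) (hyV _)
      exact (V.valuation_le_one_iff _).mpr this
    rw [h1] at hPζy'
    exact lt_irrefl _ hPζy'
  by_cases hhZ : (h : N ≃ₐ[M] N) ∈ Z
  · -- `h ∈ G_Z`: then `τ = h⁻¹ ζ` is bad and `τ w ≡ w`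
    let τ : N ≃ₐ[M] N := (h : N ≃ₐ[M] N)⁻¹ * ζ
    have hτBad : τ ∈ Bad := ⟨h, h.2, hhZ, rfl⟩
    have hτZ : τ ∈ Z := hBadZ hτBad
    have hτy : V.valuation (((τ y : N) : Ω) - y) < 1 := by
      have h1 := hZsub _ (Z.inv_mem hhZ) _ _ hh
      have h2 : (h : N ≃ₐ[M] N)⁻¹ (ζ y) = τ y := (AlgEquiv.mul_apply _ _ _).symm
      have h3 : (h : N ≃ₐ[M] N)⁻¹ ((h : N ≃ₐ[M] N) y) = y := AlgEquiv.symm_apply_apply _ _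
      rw [h2, h3] at h1
      exact h1
    have hτe : V.valuation (((τ e : N) : Ω) - 1) < 1 := by
      have h1 := hZsub τ hτZ e 1 (by push_cast; exact he1)
      rw [map_one] at h1
      push_cast at h1
      exact h1
    apply hw τ hτBad
    -- `τ w − w = (τ y − y) − (τ e − 1) τ w − (1 − e) w`
    have heq : ((τ w : N) : Ω) - w =
        (((τ y : N) : Ω) - y) + (-((((τ e : N) : Ω) - 1) * (τ w : N)) + -((1 - (e : Ω)) * w)) := by
      change _ = (((τ (e * w) : N) : Ω) - (e * w : N)) + _
      rw [map_mul]
      push_cast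
      ring
    rw [heq]
    refine Valuation.map_add_lt _ hτy (Valuation.map_add_lt _ ?_ ?_)
    · rw [Valuation.map_neg, map_mul]
      calc V.valuation (((τ e : N) : Ω) - 1) * V.valuation ((τ w : N) : Ω)
          ≤ V.valuation (((τ e : N) : Ω) - 1) * 1 :=
            mul_le_mul_right ((V.valuation_le_one_iff _).mpr (hwV τ)) _
        _ < 1 := by rw [mul_one]; exact hτe
    · rw [Valuation.map_neg, map_mul, Valuation.map_sub_swap, hvw, mul_one]
      exact he1
  · -- `h ∉ G_Z`: then `h y ∈ 𝔪` while `ζ y` is a unit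
    have h1 : V.valuation (((h : N ≃ₐ[M] N) y : N) : Ω) < 1 := hylt _ hhZ
    have h2 : V.valuation ((ζ y : N) : Ω) = 1 := hZunit ζ hζZ y hvy
    have hlt : V.valuation (((h : N ≃ₐ[M] N) y : N) : Ω) < V.valuation ((ζ y : N) : Ω) := by
      rw [h2]; exact h1
    have h3 : V.valuation (((ζ y : N) : Ω) - ((h : N ≃ₐ[M] N) y : N)) = 1 := by
      rw [V.valuation.map_sub_eq_of_lt_left hlt, h2]
    rw [h3] at hh
    exact lt_irrefl _ hh


/-! ### The main theorem -/

/-- **Every subfield of the inertia field is generated by a henselian element.** Let `N | M`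
be finite Galois inside `Ω`, `V` a valuation ring of `Ω`, and `H` a subgroup of `Gal(N|M)`
containing the inertia group `G_T` of `V ∩ N`. Then the fixed field `K' = N^H ⊆ N^{G_T}` is
`M(η)` for some `η ∈ V` which is a simple root modulo `𝔪_V` of a monic `F ∈ (V ∩ M)[X]`
with `F(η) = 0` — i.e. `V ∩ K'` is essentially of finite type ("local-étale") over `V ∩ M` at
the level of a generator. This is the elementwise content of the characterisation of the
(absolute) inertia field as the union of the local-étale finite subextensions, and the input
of [CP-I] Cor 6.3 ("`K'` between `K` and the inertia field `Kⁱ` of `W|V`").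
Construction: `η = e·η₁` with `η₁ ∈ K'` a unit all of whose conjugates lie in `V` and whose
residue is moved by every `ζ̄`, `ζ ∈ G_Z ∖ H` (`exists_witness_of_not_mem` and avoidance), and
`e ∈ K'` the orbit idempotent of `exists_crt_orbit`; then `v(σ η − η) = 0` for every `σ ∉ H`,
and `F = ∏_{σ ∈ G/H} (X − σ η)`.
[cite: KnafKuhlmann2009, Lemma 3.7 (3) (arXiv:math/0702856, p. 13: "`O_P | O_L` is local-étale
iff `(F,P)` lies in the absolute inertia field of `(L,P)`", proof: "[Ray], Ch. X, Thm. 1")]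
[cite: ZariskiSamuel1960, Ch. VI §12] [cite: CossartPiltant2008, Cor 6.3 (HAL p. 19)] -/
theorem exists_henselRoot_adjoin_eq_fixedField [FiniteDimensional M N] [IsGalois M N]
    (H : Subgroup (N ≃ₐ[M] N)) (hH : inertiaGroupIn V N ≤ H) :
    ∃ η : N, (η : Ω) ∈ V ∧ (∀ σ : N ≃ₐ[M] N, σ η = η ↔ σ ∈ H) ∧
      (∃ F : Polynomial Ω, F.Monic ∧ (∀ k, F.coeff k ∈ V ∧ F.coeff k ∈ M) ∧
        F.eval (η : Ω) = 0 ∧ V.valuation ((derivative F).eval (η : Ω)) = 1) ∧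
      fixedField H = IntermediateField.adjoin M ({η} : Set N) := by
  classical
  let O : _root_.ValuationSubring N := V.comap (algebraMap N Ω)
  let Z : Subgroup (N ≃ₐ[M] N) := decompositionGroupIn V N
  -- Step 1: an `H`-invariant unit `η₁`, all conjugates in `V`, residue moved by `G_Z ∖ H`
  have hη₁ : ∃ η₁ : N, (∀ h ∈ H, h η₁ = η₁) ∧ (∀ σ : N ≃ₐ[M] N, ((σ η₁ : N) : Ω) ∈ V) ∧
      V.valuation (η₁ : Ω) = 1 ∧
      ∀ ζ ∈ Z, ζ ∉ H → ¬ V.valuation (((ζ η₁ : N) : Ω) - η₁) < 1 := by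
    by_cases hZH : Z ≤ H
    · refine ⟨1, fun h _ => map_one h, fun σ => ?_, ?_, fun ζ hζ hζH => absurd (hZH hζ) hζH⟩
      · rw [map_one, OneMemClass.coe_one]
        exact V.one_mem
      · rw [OneMemClass.coe_one, map_one]
    · obtain ⟨ζ₀, hζ₀Z, hζ₀H⟩ := SetLike.not_le_iff_exists.mp hZH
      obtain ⟨y, ⟨hyH, hyV⟩, hy⟩ := exists_forall_not_lt_of_forall_exists V N
        (fun x : N => (∀ h ∈ H, h x = x) ∧ ∀ σ : N ≃ₐ[M] N, ((σ x : N) : Ω) ∈ V)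
        (fun x hx => by simpa using hx.2 1)
        (fun c hc => ⟨fun h _ => AlgEquiv.commutes h c, fun σ => by
          rw [AlgEquiv.commutes]; exact hc⟩)
        (fun x y hx hy => ⟨fun h hh => by rw [map_add, hx.1 h hh, hy.1 h hh], fun σ => by
          rw [map_add]; push_cast; exact V.add_mem _ _ (hx.2 σ) (hy.2 σ)⟩)
        (fun x y hx hy => ⟨fun h hh => by rw [map_mul, hx.1 h hh, hy.1 h hh], fun σ => by
          rw [map_mul]; push_cast; exact V.mul_mem _ _ (hx.2 σ) (hy.2 σ)⟩)
        ((Z : Set (N ≃ₐ[M] N)) \ (H : Set (N ≃ₐ[M] N))) (fun _ hζ => hζ.1)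
        (fun ζ hζ => by
          obtain ⟨x, hxH, hxV, hne⟩ := exists_witness_of_not_mem V N H hH hζ.1 hζ.2
          exact ⟨x, ⟨hxH, hxV⟩, hne⟩)
      have hyV1 : (y : Ω) ∈ V := by simpa using hyV 1
      have hvy : V.valuation (y : Ω) = 1 := by
        rcases ((V.valuation_le_one_iff _).mpr hyV1).lt_or_eq with h1 | h1
        · exfalso
          refine hy ζ₀ ⟨hζ₀Z, hζ₀H⟩ ?_
          rw [sub_eq_add_neg]
          refine Valuation.map_add_lt _
            ((valuation_lt_one_iff_of_mem_decompositionGroupIn V N hζ₀Z y).mp h1) ?_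
          rwa [Valuation.map_neg]
        · exact h1
      exact ⟨y, hyH, hyV, hvy, fun ζ hζ hζH => hy ζ ⟨hζ, hζH⟩⟩
  obtain ⟨η₁, hη₁H, hη₁V, hvη₁, hη₁⟩ := hη₁
  have hη₁V1 : (η₁ : Ω) ∈ V := by simpa using hη₁V 1
  -- Step 2: the orbit idempotent `e` and `η = e η₁`
  obtain ⟨e, heH, heV, he1, helt⟩ := exists_crt_orbit V N H
  let η : N := e * η₁
  have hηH : ∀ h ∈ H, h η = η := fun h hh => by
    change h (e * η₁) = e * η₁
    rw [map_mul, heH h hh, hη₁H h hh]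
  have hηV' : ∀ σ : N ≃ₐ[M] N, ((σ η : N) : Ω) ∈ V := fun σ => by
    change ((σ (e * η₁) : N) : Ω) ∈ V
    rw [map_mul]
    push_cast
    exact V.mul_mem _ _ (heV σ) (hη₁V σ)
  have hηV : (η : Ω) ∈ V := by simpa using hηV' 1
  have hηη₁ : V.valuation ((η : Ω) - η₁) < 1 := by
    have heq : (η : Ω) - η₁ = ((e : Ω) - 1) * η₁ := by
      change ((e * η₁ : N) : Ω) - η₁ = _
      push_cast
      ring
    rw [heq, map_mul, hvη₁, mul_one]
    exact he1
  have hvη : V.valuation (η : Ω) = 1 := by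
    have heq : (η : Ω) = η₁ + ((η : Ω) - η₁) := by ring
    have hlt : V.valuation ((η : Ω) - η₁) < V.valuation (η₁ : Ω) := by rw [hvη₁]; exact hηη₁
    rw [heq, V.valuation.map_add_eq_of_lt_left hlt, hvη₁]
  -- KEY: `v(σ η − η) = 0` for `σ ∉ H`
  have hkey : ∀ σ : N ≃ₐ[M] N, σ ∉ H → V.valuation (((σ η : N) : Ω) - η) = 1 := by
    intro σ hσ
    by_cases horb : ∃ h ∈ H, σ⁻¹ • O = h • O
    · obtain ⟨h, hhH, hhO⟩ := horb
      have hζZ : σ * h ∈ Z := by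
        have h1 : (h⁻¹ * σ⁻¹) • O = O := by
          rw [mul_smul, hhO, ← mul_smul, inv_mul_cancel, one_smul]
        have h2 := Z.inv_mem ((mem_decompositionGroupIn_iff_smul_eq V N (h⁻¹ * σ⁻¹)).mpr h1)
        rwa [mul_inv_rev, inv_inv, inv_inv] at h2
      have hζH : σ * h ∉ H := fun h1 => hσ (by
        have h2 := H.mul_mem h1 (H.inv_mem hhH)
        rwa [mul_inv_cancel_right] at h2)
      have hση : σ η = (σ * h) η := by rw [AlgEquiv.mul_apply, hηH h hhH]
      rw [hση]
      set ζ : N ≃ₐ[M] N := σ * h with hζ_def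
      have hmid : V.valuation (((ζ η₁ : N) : Ω) - η₁) = 1 :=
        le_antisymm ((V.valuation_le_one_iff _).mpr (sub_mem (hη₁V ζ) hη₁V1))
          (not_lt.mp (hη₁ ζ hζZ hζH))
      have hζe : V.valuation (((ζ e : N) : Ω) - 1) < 1 := by
        have h1 := valuation_map_sub_lt_one_of_mem_decompositionGroupIn V N hζZ
          (x := e) (y := 1) (by push_cast; exact he1)
        rw [map_one] at h1
        push_cast at h1
        exact h1
      have hsmall : V.valuation ((((ζ e : N) : Ω) - 1) * (ζ η₁ : N) + (1 - (e : Ω)) * η₁) < 1 := by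
        refine Valuation.map_add_lt _ ?_ ?_
        · rw [map_mul]
          calc V.valuation (((ζ e : N) : Ω) - 1) * V.valuation ((ζ η₁ : N) : Ω)
              ≤ V.valuation (((ζ e : N) : Ω) - 1) * 1 :=
                mul_le_mul_right ((V.valuation_le_one_iff _).mpr (hη₁V ζ)) _
            _ < 1 := by rw [mul_one]; exact hζe
        · rw [map_mul, Valuation.map_sub_swap, hvη₁, mul_one]
          exact he1
      have heq : ((ζ η : N) : Ω) - η =
          (((ζ η₁ : N) : Ω) - η₁) + ((((ζ e : N) : Ω) - 1) * (ζ η₁ : N) + (1 - (e : Ω)) * η₁) := by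
        change ((ζ (e * η₁) : N) : Ω) - (e * η₁ : N) = _
        rw [map_mul]
        push_cast
        ring
      have hlt : V.valuation ((((ζ e : N) : Ω) - 1) * (ζ η₁ : N) + (1 - (e : Ω)) * η₁) <
          V.valuation (((ζ η₁ : N) : Ω) - η₁) := by rw [hmid]; exact hsmall
      rw [heq, V.valuation.map_add_eq_of_lt_left hlt, hmid]
    · push Not at horb
      have hσe : V.valuation ((σ e : N) : Ω) < 1 := helt σ horb
      have hση : V.valuation ((σ η : N) : Ω) < 1 := by
        change V.valuation ((σ (e * η₁) : N) : Ω) < 1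
        rw [map_mul]
        push_cast
        rw [map_mul]
        calc V.valuation ((σ e : N) : Ω) * V.valuation ((σ η₁ : N) : Ω)
            ≤ V.valuation ((σ e : N) : Ω) * 1 :=
              mul_le_mul_right ((V.valuation_le_one_iff _).mpr (hη₁V σ)) _
          _ < 1 := by rw [mul_one]; exact hσe
      have hlt : V.valuation ((σ η : N) : Ω) < V.valuation (η : Ω) := by rw [hvη]; exact hση
      rw [Valuation.map_sub_swap, V.valuation.map_sub_eq_of_lt_left hlt, hvη]
  -- the stabiliser of `η` is `H`
  have hstab : ∀ σ : N ≃ₐ[M] N, σ η = η ↔ σ ∈ H := fun σ =>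
    ⟨fun h => by
      by_contra hσ
      have h1 := hkey σ hσ
      rw [h, sub_self, map_zero] at h1
      exact zero_ne_one h1, fun hσ => hηH σ hσ⟩
  have hstab' : MulAction.stabilizer (N ≃ₐ[M] N) η = H := by
    ext σ
    rw [MulAction.mem_stabilizer_iff, AlgEquiv.smul_def, hstab]
  -- the polynomial `F = ∏_{σ ∈ G/H} (X − σ η)`
  haveI : Fintype (N ≃ₐ[M] N) := Fintype.ofFinite _
  let FN : N[X] := ∏ q : (N ≃ₐ[M] N) ⧸ MulAction.stabilizer (N ≃ₐ[M] N) η,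
      (X - C (MulAction.ofQuotientStabilizer (N ≃ₐ[M] N) η q))
  have hFN : FN = ∏ q : (N ≃ₐ[M] N) ⧸ MulAction.stabilizer (N ≃ₐ[M] N) η,
      (X - C (MulAction.ofQuotientStabilizer (N ≃ₐ[M] N) η q)) := rfl
  have hFNsmul : ∀ g : N ≃ₐ[M] N, g • FN = FN := fun g => by
    rw [hFN, Finset.smul_prod']
    exact Fintype.prod_bijective _ (MulAction.bijective g) _ _ fun q => by
      rw [MulAction.ofQuotientStabilizer_smul, smul_sub, Polynomial.smul_X, Polynomial.smul_C]
  have hFNmonic : FN.Monic := monic_prod_of_monic _ _ fun _ _ => monic_X_sub_C _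
  have hFNeval : FN.eval η = 0 := by
    rw [hFN, eval_prod]
    refine Finset.prod_eq_zero
      (Finset.mem_univ (QuotientGroup.mk 1 : (N ≃ₐ[M] N) ⧸ MulAction.stabilizer (N ≃ₐ[M] N) η)) ?_
    rw [MulAction.ofQuotientStabilizer_mk, one_smul, eval_sub, eval_X, eval_C, sub_self]
  have hroots : ∀ q : (N ≃ₐ[M] N) ⧸ MulAction.stabilizer (N ≃ₐ[M] N) η,
      ((MulAction.ofQuotientStabilizer (N ≃ₐ[M] N) η q : N) : Ω) ∈ V := by
    intro q
    obtain ⟨g, rfl⟩ := QuotientGroup.mk_surjective q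
    rw [MulAction.ofQuotientStabilizer_mk, AlgEquiv.smul_def]
    exact hηV' g
  have hcoeffV : ∀ k, ((FN.coeff k : N) : Ω) ∈ V := fun k => by
    rw [hFN]
    exact coeff_prod_X_sub_C_mem O Finset.univ _ (fun q _ => hroots q) k
  have hcoeffM : ∀ k, ((FN.coeff k : N) : Ω) ∈ M := by
    intro k
    have hfix : ∀ g : N ≃ₐ[M] N, g (FN.coeff k) = FN.coeff k := fun g => by
      have h : g • FN.coeff k = FN.coeff k := by rw [← Polynomial.coeff_smul, hFNsmul]
      rwa [AlgEquiv.smul_def] at h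
    obtain ⟨m, hm⟩ := (IntermediateField.mem_bot.mp ((IsGalois.mem_bot_iff_fixed _).mpr hfix))
    rw [← hm]
    exact m.2
  let F : Polynomial Ω := FN.map (algebraMap N Ω)
  have hFcoeff : ∀ k, F.coeff k = ((FN.coeff k : N) : Ω) := fun k => Polynomial.coeff_map _ _
  have hFeval : F.eval (η : Ω) = 0 := by
    change (FN.map (algebraMap N Ω)).eval (algebraMap N Ω η) = 0
    rw [eval_map, eval₂_hom, hFNeval, map_zero]
  -- the derivative at `η`: a product of units `η − g η`, `g ∉ H`
  have hFder : V.valuation ((derivative F).eval (η : Ω)) = 1 := by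
    let q₁ : (N ≃ₐ[M] N) ⧸ MulAction.stabilizer (N ≃ₐ[M] N) η := QuotientGroup.mk 1
    let B : N[X] := ∏ q ∈ Finset.univ.erase q₁,
      (X - C (MulAction.ofQuotientStabilizer (N ≃ₐ[M] N) η q))
    have hsplit : FN = (X - C η) * B := by
      rw [hFN, ← Finset.mul_prod_erase Finset.univ _ (Finset.mem_univ q₁)]
      congr 2
    have hderN : (derivative FN).eval η = B.eval η := by
      rw [hsplit, derivative_mul, derivative_sub, derivative_X, derivative_C, sub_zero, one_mul,
        eval_add, eval_mul, eval_sub, eval_X, eval_C, sub_self, zero_mul, add_zero]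
    have hder : (derivative F).eval (η : Ω) = algebraMap N Ω (B.eval η) := by
      change (derivative (FN.map (algebraMap N Ω))).eval (algebraMap N Ω η) = _
      rw [derivative_map, eval_map, eval₂_hom, hderN]
    rw [hder, eval_prod]
    change V.valuation (((∏ q ∈ Finset.univ.erase q₁,
      (X - C (MulAction.ofQuotientStabilizer (N ≃ₐ[M] N) η q)).eval η : N) : Ω)) = 1
    push_cast
    refine ValuationSubring.valuation_prod_eq_one V _ _ fun q hq => ?_
    rw [eval_sub, eval_X, eval_C]
    obtain ⟨g, rfl⟩ := QuotientGroup.mk_surjective q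
    have hgH : g ∉ H := by
      intro hgH
      apply (Finset.mem_erase.mp hq).1
      change (QuotientGroup.mk g : (N ≃ₐ[M] N) ⧸ MulAction.stabilizer (N ≃ₐ[M] N) η) =
        QuotientGroup.mk 1
      rw [QuotientGroup.eq, mul_one, hstab']
      exact H.inv_mem hgH
    rw [MulAction.ofQuotientStabilizer_mk, AlgEquiv.smul_def]
    push_cast
    rw [Valuation.map_sub_swap]
    exact hkey g hgH
  refine ⟨η, hηV, hstab, ⟨F, hFNmonic.map _, fun k => ?_, hFeval, hFder⟩, ?_⟩
  · rw [hFcoeff]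
    exact ⟨hcoeffV k, hcoeffM k⟩
  · -- `N^H = M(η)`
    apply le_antisymm
    · have h1 : (IntermediateField.adjoin M ({η} : Set N)).fixingSubgroup ≤ H := by
        intro σ hσ
        rw [← hstab σ]
        exact (IntermediateField.mem_fixingSubgroup_iff _ _).mp hσ η
          (IntermediateField.mem_adjoin_simple_self M η)
      intro x hx
      rw [← IsGalois.fixedField_fixingSubgroup (IntermediateField.adjoin M ({η} : Set N))]
      rw [IntermediateField.mem_fixedField_iff] at hx ⊢
      exact fun σ hσ => hx σ (h1 hσ)
    · exact IntermediateField.adjoin_le_iff.mpr (Set.singleton_subset_iff.mpr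
        ((IntermediateField.mem_fixedField_iff _ _).mpr fun σ hσ => hηH σ hσ))

/-- The same, read in `Ω`: for `G_T ≤ H`, `N^H = M(η)` as subfields of `Ω` with `η` a henselian
element over `V ∩ M` (the shape consumed by the étale climb
`exists_model_of_henselRoot_of_cofinal` of `ArithmeticalThreefoldsLocalUnramifiedClimb.lean`).
[folklore] -/
theorem exists_henselRoot_toSubfield_fixedField_eq [FiniteDimensional M N] [IsGalois M N]
    (H : Subgroup (N ≃ₐ[M] N)) (hH : inertiaGroupIn V N ≤ H) :
    ∃ η : Ω, η ∈ V ∧ η ∈ lift (fixedField H) ∧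
      (∃ F : Polynomial Ω, F.Monic ∧ (∀ k, F.coeff k ∈ V ∧ F.coeff k ∈ M) ∧
        F.eval η = 0 ∧ V.valuation ((derivative F).eval η) = 1) ∧
      (lift (fixedField H)).toSubfield = (IntermediateField.adjoin M ({η} : Set Ω)).toSubfield := by
  obtain ⟨η, hηV, hstab, hF, hfield⟩ := exists_henselRoot_adjoin_eq_fixedField V N H hH
  refine ⟨η, hηV, (IntermediateField.mem_lift η).mpr ?_, hF, ?_⟩
  · rw [hfield]
    exact IntermediateField.mem_adjoin_simple_self M η
  · rw [hfield, IntermediateField.lift_adjoin_simple]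

/-- In particular (take `H = Gal(N | K')`): every intermediate field `K'` of `N | M` contained
in the inertia field `N^{G_T}` of `V ∩ N` is `M(η)` for a henselian element `η` over `V ∩ M`.
[cite: KnafKuhlmann2009, Lemma 3.7 (3)] [cite: CossartPiltant2008, Cor 6.3 (HAL p. 19)] -/
theorem exists_henselRoot_adjoin_eq_of_le_inertiaField [FiniteDimensional M N] [IsGalois M N]
    (K' : IntermediateField M N) (hK' : K' ≤ fixedField (inertiaGroupIn V N)) :
    ∃ η : N, (η : Ω) ∈ V ∧
      (∃ F : Polynomial Ω, F.Monic ∧ (∀ k, F.coeff k ∈ V ∧ F.coeff k ∈ M) ∧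
        F.eval (η : Ω) = 0 ∧ V.valuation ((derivative F).eval (η : Ω)) = 1) ∧
      K' = IntermediateField.adjoin M ({η} : Set N) := by
  have hH : inertiaGroupIn V N ≤ K'.fixingSubgroup := (IntermediateField.le_iff_le _ _).mp hK'
  obtain ⟨η, hηV, -, hF, hfield⟩ := exists_henselRoot_adjoin_eq_fixedField V N K'.fixingSubgroup hH
  rw [IsGalois.fixedField_fixingSubgroup] at hfield
  exact ⟨η, hηV, hF, hfield⟩

end InertiaSubfields

end Literature.AlgebraicGeometry.Resolution

end
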